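import Literature.NumberTheory.EllipticCurves.SzpiroFreyProofs

/-!
# Frey covariants: minimality and conductor of any integral model with
`c₄ = 16(A²+AB+B²)`, `Δ = 16(AB(A+B))²`

Support file for the negative side (cdisprove) of crux `TwistAmplification.SomeWindowSaving`
(stmt-ABC-1976).  Bombieri–Gubler Ex. 12.5.10, first case (`A, B` coprime, `16 ∤ AB(A+B)`), proved
in the tree for the model (12.17) (`isMinimalAt_freyIntModel`, `conductorNorm_freyIntModel_dvd`),
transported to ANY integral model with the same covariants — in particular to reduced translates,
which is what the crux counts: global minimality at every place, `N ∣ 2¹⁰ rad(AB(A+B))`, and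
`q ∣ N` for every odd prime `q ∣ AB(A+B)` (multiplicative reduction, `f_q = 1`).
-/

noncomputable section

open UniqueFactorizationMonoid IsDedekindDomain Real WeierstrassCurve Rat.HeightOneSpectrum
open Literature.NumberTheory.EllipticCurves

namespace Summit.ABC.ABC.Theorems.SomeWindowSaving.Negative

section FreyLike

variable {A B : ℤ} {W₀ : WeierstrassCurve ℤ}

/-- Such a model is an elliptic curve. -/
theorem isElliptic_of_freyCovariants (h0 : A * B * (A + B) ≠ 0)
    (hΔ : W₀.Δ = 16 * (A * B * (A + B)) ^ 2) : (W₀.baseChange ℚ).IsElliptic := by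
  refine ⟨?_⟩
  rw [baseChange_int_Δ, hΔ, isUnit_iff_ne_zero]
  exact_mod_cast mul_ne_zero (by norm_num) (pow_ne_zero 2 h0)

/-- B–G 12.5.10, first case, for any integral model with the Frey covariants: global minimality. -/
theorem isMinimalAt_of_freyCovariants (hAB : IsCoprime A B) (h0 : A * B * (A + B) ≠ 0)
    (h16 : ¬ (16 : ℤ) ∣ A * B * (A + B))
    (hc₄ : W₀.c₄ = 16 * (A ^ 2 + A * B + B ^ 2)) (hΔ : W₀.Δ = 16 * (A * B * (A + B)) ^ 2)
    (v : HeightOneSpectrum ℤ) : (W₀.baseChange ℚ).IsMinimalAt v := by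
  set p := natGenerator v with hp
  have hpp : p.Prime := prime_natGenerator v
  by_cases hpm : (p : ℤ) ∣ A * B * (A + B)
  · by_cases h2 : p = 2
    · refine isMinimalAt_baseChange_int_of_not_pow_dvd_Δ ?_
      rw [← hp, h2, hΔ]
      intro h
      have h' : (2 : ℤ) ^ 12 ∣ 16 * (A * B * (A + B)) ^ 2 := by exact_mod_cast h
      exact not_two_pow_eleven_dvd h0 h16 (dvd_trans (pow_dvd_pow 2 (by norm_num : 11 ≤ 12)) h')
    · refine isMinimalAt_baseChange_int_of_not_dvd_c₄ ?_
      rw [← hp, hc₄]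
      intro h
      have hpint : Prime (p : ℤ) := Nat.prime_iff_prime_int.mp hpp
      rcases hpint.dvd_or_dvd h with h | h
      · exact h2 (eq_two_of_dvd_sixteen hpp h)
      · exact not_dvd_sq_add_mul_add_sq hAB hpp hpm h
  · refine isMinimalAt_baseChange_int_of_not_pow_dvd_Δ ?_
    rw [← hp, hΔ]
    intro h
    have hpint : Prime (p : ℤ) := Nat.prime_iff_prime_int.mp hpp
    have h5 : (p : ℤ) ^ 5 ∣ 16 * (A * B * (A + B)) ^ 2 := dvd_trans (pow_dvd_pow _ (by norm_num)) h
    have hp16 : (p : ℤ) ∣ 16 := by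
      rcases hpint.dvd_or_dvd (dvd_trans (dvd_pow_self _ (by norm_num)) h5) with h | h
      · exact h
      · exact absurd (hpint.dvd_of_dvd_pow h) hpm
    have hp2 : p = 2 := eq_two_of_dvd_sixteen hpp hp16
    apply hpm
    rw [hp2] at h5 ⊢
    have h5' : (16 : ℤ) * 2 ∣ 16 * (A * B * (A + B)) ^ 2 := by
      have : ((2 : ℕ) : ℤ) ^ 5 = 16 * 2 := by norm_num
      rwa [this] at h5
    have h2m : (2 : ℤ) ∣ (A * B * (A + B)) ^ 2 :=
      (mul_dvd_mul_iff_left (by norm_num : (16 : ℤ) ≠ 0)).mp h5'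
    exact_mod_cast Int.prime_two.dvd_of_dvd_pow h2m

/-- B–G 12.5.10, first case, for any integral model with the Frey covariants:
`N ∣ 2¹⁰ · rad (AB(A+B))`. -/
theorem conductorNorm_dvd_of_freyCovariants (hAB : IsCoprime A B) (h0 : A * B * (A + B) ≠ 0)
    (h16 : ¬ (16 : ℤ) ∣ A * B * (A + B))
    (hc₄ : W₀.c₄ = 16 * (A ^ 2 + A * B + B ^ 2)) (hΔ : W₀.Δ = 16 * (A * B * (A + B)) ^ 2) :
    (W₀.baseChange ℚ).conductorNorm ℤ ∣ 2 ^ 10 * radical (A * B * (A + B)).natAbs := by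
  haveI := isElliptic_of_freyCovariants h0 hΔ
  set m := A * B * (A + B) with hm
  have hm0 : m.natAbs ≠ 0 := Int.natAbs_ne_zero.mpr h0
  refine conductorNorm_dvd_of_forall_conductorExponent_le _
    (mul_ne_zero (by positivity) radical_ne_zero) fun p ↦ ?_
  obtain ⟨v, hv⟩ := exists_place p
  obtain ⟨p, hp⟩ := p
  simp only at hv ⊢
  have hmin := isMinimalAt_of_freyCovariants hAB h0 h16 hc₄ hΔ v
  have hpint : Prime (p : ℤ) := Nat.prime_iff_prime_int.mp hp
  rw [show (primesEquiv (R := ℤ)).symm ⟨p, hp⟩ = v from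
      (primesEquiv (R := ℤ)).symm_apply_eq.mpr (Subtype.ext hv.symm),
    Nat.factorization_mul (by positivity) radical_ne_zero, Finsupp.add_apply,
    Literature.NumberTheory.DiophantineGeometry.factorization_radical_apply hm0 hp, Nat.Prime.factorization_pow Nat.prime_two,
    Finsupp.single_apply]
  by_cases h2 : p = 2
  · subst h2
    have : (W₀.baseChange ℚ).conductorExponent v < 11 := by
      refine conductorExponent_lt_of_not_pow_dvd hmin ?_
      rw [hv, hΔ]
      exact_mod_cast not_two_pow_eleven_dvd h0 h16
    rw [if_pos rfl]; omega
  rw [if_neg (Ne.symm h2), zero_add]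
  by_cases hpm : (p : ℤ) ∣ m
  · rw [if_pos (Int.natCast_dvd.mp hpm)]
    refine (conductorExponent_eq_one_of_dvd_Δ_of_not_dvd_c₄ hmin ?_ ?_).le
    · rw [hv, hΔ]
      exact dvd_mul_of_dvd_right (dvd_pow hpm two_ne_zero) _
    · rw [hv, hc₄]
      intro h
      rcases hpint.dvd_or_dvd h with h | h
      · exact h2 (eq_two_of_dvd_sixteen hp h)
      · exact not_dvd_sq_add_mul_add_sq hAB hp hpm h
  · rw [if_neg (mt Int.natCast_dvd.mpr hpm)]
    refine (conductorExponent_eq_zero_of_not_dvd_Δ hmin ?_).le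
    rw [hv, hΔ]
    intro h
    rcases hpint.dvd_or_dvd h with h | h
    · exact h2 (eq_two_of_dvd_sixteen hp h)
    · exact hpm (hpint.dvd_of_dvd_pow h)

/-- Multiplicative primes divide the conductor: for an odd prime `q ∣ AB(A+B)`, `q ∣ N`
(`f_q = 1`). -/
theorem dvd_conductorNorm_of_freyCovariants (hAB : IsCoprime A B) (h0 : A * B * (A + B) ≠ 0)
    (h16 : ¬ (16 : ℤ) ∣ A * B * (A + B))
    (hc₄ : W₀.c₄ = 16 * (A ^ 2 + A * B + B ^ 2)) (hΔ : W₀.Δ = 16 * (A * B * (A + B)) ^ 2)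
    {q : ℕ} (hq : q.Prime) (hq2 : q ≠ 2) (hqm : (q : ℤ) ∣ A * B * (A + B)) :
    q ∣ (W₀.baseChange ℚ).conductorNorm ℤ := by
  haveI := isElliptic_of_freyCovariants h0 hΔ
  have hN0 : (W₀.baseChange ℚ).conductorNorm ℤ ≠ 0 := (conductorNorm_pos_holds _).ne'
  obtain ⟨v, hv⟩ := exists_place ⟨q, hq⟩
  simp only at hv
  have hmin := isMinimalAt_of_freyCovariants hAB h0 h16 hc₄ hΔ v
  have hqint : Prime (q : ℤ) := Nat.prime_iff_prime_int.mp hq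
  have h1 : (W₀.baseChange ℚ).conductorExponent v = 1 := by
    refine conductorExponent_eq_one_of_dvd_Δ_of_not_dvd_c₄ hmin ?_ ?_
    · rw [hv, hΔ]
      exact dvd_mul_of_dvd_right (dvd_pow hqm two_ne_zero) _
    · rw [hv, hc₄]
      intro h
      rcases hqint.dvd_or_dvd h with h | h
      · exact hq2 (eq_two_of_dvd_sixteen hq h)
      · exact not_dvd_sq_add_mul_add_sq hAB hq hqm h
  have hfac : ((W₀.baseChange ℚ).conductorNorm ℤ).factorization q = 1 := by
    rw [show q = ((⟨q, hq⟩ : Nat.Primes) : ℕ) from rfl, factorization_conductorNorm_primesEquiv_symm,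
      show (primesEquiv (R := ℤ)).symm ⟨q, hq⟩ = v from
        (primesEquiv (R := ℤ)).symm_apply_eq.mpr (Subtype.ext hv.symm)]
    exact h1
  exact (Nat.Prime.dvd_iff_one_le_factorization hq hN0).mpr (by omega)

end FreyLike

end Summit.ABC.ABC.Theorems.SomeWindowSaving.Negative
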